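import Summits.Ventures.PercRepro2.CaseOneTwoMarkRed

/-!
# `a₃` adjacent exactly to `o` and `b`: the `r_o²` row is certified, and `(ii)` is unconditional
(blind cell PercRepro2, p1 g15; S5 §2.1 (K9) (l), proofs/P1-TWOMARK.md)

`CaseOneTwoMarkRed.lean` reduced `(ii)` for the class «`a₃` adjacent exactly to `o` and `b`» to the
three Bernstein coefficients `B₂₁, B₂₂, B₂₃` (the `r_o²` row) at the base masses
(`zSplitII_of_twoMark_of_bern`), which had no certificate over the pairwise atoms multiplied by the
13 base linear forms. In the **9-cell vocabulary** — the masses `m_xy = P₀(Q₀, o-status x, b-status y)`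
with `x, y ∈ {C₁, C₂, neither}`, all nonnegative — every one of the three IS a nonnegative combination
of `(pairwise atom) × (cell)` and of cell monomials (exact LP, 40 / 32 / 11 terms, verified by exact
polynomial arithmetic; `mining/p1/g15/certs_B2row.txt`):

* `B₂₃`: BHK 1.4 with `C₁` avoiding `{a₂, b}` and the odds lemma at `b` (by hand:
  `9·B₂₃ = 3·P(Q,B)|_{r=s=1}·[E₀·H + A_o·E₀ + av_b]`, the `(ii)`-shape of `−∂_r iiQ` at `r = 1`);
* `B₂₂`: + BHK 1.4 with `C₂` avoiding `{a₁, b}` (`tm_bhk_avoid_c2_b`), `C₁` avoiding `{a₂, o}`, the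
  Q-pair odds conditions at `b` and at `o` (`tm_oddsQ_o`);
* `B₂₁`: + BHK 1.3 on `C₁` (`tm_bhk_same_a1`), BHK 1.4 (`b ∈ C₂` vs `o ∈ C₁`), `C₂` avoiding `{a₁, o}`.

Hence **`zSplitII_of_twoMark`**: `(ii)` for `a₃ ~ {o, b}`, every finite graph, every weight vector —
and `rv_of_twoMark`: `(RV)` there when the required-vertex world has mass. -/

namespace Summit.Ventures.PercRepro2

namespace CaseOne

section Atoms2
variable {V : Type*} {E : Type*} [Fintype E] [DecidableEq E] [Fintype V] [DecidableEq V]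
  {R : Type*} [Field R] [LinearOrder R] [IsStrictOrderedRing R]

/-- **BHK 1.3 on `C₁` under `Q₀`** (atom H13C1): `P(Q₀, O₁) · P(Q₀, B₁) ≤ P(Q₀, O₁, B₁) · P(Q₀)`. -/
lemma tm_bhk_same_a1 (p : E → R) (hp : IsProbVec p) (ends : E → Sym2 V) (o a₁ a₂ b : V) :
    prob p ((connEvent ends a₁ a₂)ᶜ ∩ connEvent ends a₁ o) *
        prob p ((connEvent ends a₁ a₂)ᶜ ∩ connEvent ends a₁ b) ≤
      prob p ((connEvent ends a₁ a₂)ᶜ ∩ connEvent ends a₁ o ∩ connEvent ends a₁ b) *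
        prob p (connEvent ends a₁ a₂)ᶜ := by
  have h := bhk_same_cluster_events p hp ends a₁ a₂ (isUpperSet_mem_setOf o) (isUpperSet_mem_setOf b)
  rw [← connEvent_eq_clusterInEvent, ← connEvent_eq_clusterInEvent] at h
  have e1 : connEvent ends a₁ o ∩ (connEvent ends a₁ a₂)ᶜ =
      (connEvent ends a₁ a₂)ᶜ ∩ connEvent ends a₁ o := Set.inter_comm _ _
  have e2 : connEvent ends a₁ b ∩ (connEvent ends a₁ a₂)ᶜ =
      (connEvent ends a₁ a₂)ᶜ ∩ connEvent ends a₁ b := Set.inter_comm _ _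
  have e3 : connEvent ends a₁ o ∩ connEvent ends a₁ b ∩ (connEvent ends a₁ a₂)ᶜ =
      (connEvent ends a₁ a₂)ᶜ ∩ connEvent ends a₁ o ∩ connEvent ends a₁ b := by
    ext ω
    simp only [Set.mem_inter_iff, Set.mem_compl_iff]
    tauto
  rw [prob_congr_set p e1, prob_congr_set p e2, prob_congr_set p e3] at h
  exact h

/-- **The Q-pair odds condition at `o`** (atom oddsQ_o, the mirror of `tm_oddsQ_b`):
`P(Q₀) · P(Q₀, O₁, B₂) ≤ P(Q₀, O₁) · P(Q₀, b ∈ U)`. -/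
lemma tm_oddsQ_o (p : E → R) (hp : IsProbVec p) (ends : E → Sym2 V) (o a₁ a₂ b : V) :
    prob p (connEvent ends a₁ a₂)ᶜ *
        prob p ((connEvent ends a₁ a₂)ᶜ ∩ connEvent ends a₁ o ∩ connEvent ends a₂ b) ≤
      prob p ((connEvent ends a₁ a₂)ᶜ ∩ connEvent ends a₁ o) *
        prob p ((connEvent ends a₁ a₂)ᶜ ∩ (connEvent ends a₁ b ∪ connEvent ends a₂ b)) :=
  tm_oddsQ_b p hp ends b a₁ a₂ o

/-- **BHK 1.4 with `C₂` avoiding `{a₁, b}`, `o ∈ C₂` against `b ∈ C₁`** (atom H14av_b):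
`P(Q₀, B₁, O₂) · (P(Q₀) − P(Q₀, B₂)) ≤ (P(Q₀, O₂) − P(Q₀, O₂, B₂)) · P(Q₀, B₁)`. -/
lemma tm_bhk_avoid_c2_b (p : E → R) (hp : IsProbVec p) (ends : E → Sym2 V) (o a₁ a₂ b : V) :
    prob p ((connEvent ends a₁ a₂)ᶜ ∩ connEvent ends a₁ b ∩ connEvent ends a₂ o) *
        (prob p (connEvent ends a₁ a₂)ᶜ - prob p ((connEvent ends a₁ a₂)ᶜ ∩ connEvent ends a₂ b)) ≤
      (prob p ((connEvent ends a₁ a₂)ᶜ ∩ connEvent ends a₂ o) -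
          prob p ((connEvent ends a₁ a₂)ᶜ ∩ connEvent ends a₂ o ∩ connEvent ends a₂ b)) *
        prob p ((connEvent ends a₁ a₂)ᶜ ∩ connEvent ends a₁ b) := by
  have h' := tm_bhk_avoid_c1 p hp ends b a₂ a₁ o
  rw [connEvent_comm ends a₂ a₁] at h'
  have e1 : (connEvent ends a₁ a₂)ᶜ ∩ connEvent ends a₂ o ∩ connEvent ends a₁ b =
      (connEvent ends a₁ a₂)ᶜ ∩ connEvent ends a₁ b ∩ connEvent ends a₂ o := Set.inter_right_comm _ _ _
  have e2 : (connEvent ends a₁ a₂)ᶜ ∩ connEvent ends a₂ b ∩ connEvent ends a₂ o =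
      (connEvent ends a₁ a₂)ᶜ ∩ connEvent ends a₂ o ∩ connEvent ends a₂ b := Set.inter_right_comm _ _ _
  rw [prob_congr_set p e1, prob_congr_set p e2] at h'
  exact h'

end Atoms2

section CoeffsNonneg
variable {R : Type*} [CommRing R] [LinearOrder R] [IsStrictOrderedRing R]

/-- **`9·B₂₃ ≥ 0`, the cell certificate** (11 terms): BHK 1.4 with `C₁` avoiding `{a₂, b}` (`hA4'`)
and the odds lemma at `b` (`hA6`), each multiplied by cells, plus cell monomials — an identity modulo
the relations `oU = o₁ + o₂`, `bU = b₁ + b`, `oUbU = ob + bo₁ + ob₁ + o₁b₁`. -/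
lemma tmB23_nonneg (m : TMMasses R) (hoU : m.oU = m.o₁ + m.o₂) (hbU : m.bU = m.b₁ + m.b)
    (hoUbU : m.oUbU = m.ob + m.bo₁ + m.ob₁ + m.o₁b₁)
    (hc12 : 0 ≤ m.bo₁) (hc1N : 0 ≤ m.o₁ - m.o₁b₁ - m.bo₁) (hc22 : 0 ≤ m.ob)
    (hc2N : 0 ≤ m.o₂ - m.ob₁ - m.ob) (hcN2 : 0 ≤ m.b - m.ob - m.bo₁)
    (hcNN : 0 ≤ m.M - m.oU - m.bU + m.oUbU)
    (hA4' : m.bo₁ * (m.M - m.b₁) ≤ (m.o₁ - m.o₁b₁) * m.b)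
    (hA6 : (m.M - m.bU) * m.ob₁ ≤ (m.oU - m.oUbU) * m.b₁) : 0 ≤ tmB23 m := by
  unfold tmB23
  rw [hoU, hbU, hoUbU] at hcNN
  rw [hbU, hoU, hoUbU] at hA6
  rw [hoU, hbU, hoUbU]
  have t1 := mul_nonneg (sub_nonneg.2 hA4') hc1N
  have t2 := mul_nonneg (sub_nonneg.2 hA4') hc2N
  have t3 := mul_nonneg (sub_nonneg.2 hA6) hc22
  have t4 := mul_nonneg (sub_nonneg.2 hA6) hc2N
  have t5 := mul_nonneg (sub_nonneg.2 hA6) hcN2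
  have t6 := mul_nonneg (mul_nonneg hc12 hc1N) hc2N
  have t7 := mul_nonneg (mul_nonneg hc12 hc1N) hcNN
  have t8 := mul_nonneg (mul_nonneg hc12 hc2N) hc2N
  have t9 := mul_nonneg (mul_nonneg hc12 hc2N) hcNN
  have t10 := mul_nonneg (mul_nonneg hc1N hc1N) hc2N
  have t11 := mul_nonneg (mul_nonneg hc1N hc2N) hc2N
  linarith [t1, t2, t3, t4, t5, t6, t7, t8, t9, t10, t11]

/-- **`9·B₂₂ ≥ 0`, the cell certificate** (32 terms): BHK 1.4 with `C₂` avoiding `{a₁, b}` (`hA7'`),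
with `C₁` avoiding `{a₂, o}` (`hA4`) and `{a₂, b}` (`hA4'`), the odds lemma at `b` (`hA6`), the
Q-pair odds conditions at `b` (`hA5`) and at `o` (`hA5'`), each multiplied by cells, plus cell
monomials — an identity modulo the relations. -/
lemma tmB22_nonneg (m : TMMasses R) (hoU : m.oU = m.o₁ + m.o₂) (hbU : m.bU = m.b₁ + m.b)
    (hoUbU : m.oUbU = m.ob + m.bo₁ + m.ob₁ + m.o₁b₁)
    (hc11 : 0 ≤ m.o₁b₁) (hc12 : 0 ≤ m.bo₁) (hc1N : 0 ≤ m.o₁ - m.o₁b₁ - m.bo₁) (hc21 : 0 ≤ m.ob₁)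
    (hc22 : 0 ≤ m.ob) (hc2N : 0 ≤ m.o₂ - m.ob₁ - m.ob) (hcN2 : 0 ≤ m.b - m.ob - m.bo₁)
    (hcNN : 0 ≤ m.M - m.oU - m.bU + m.oUbU)
    (hA4 : m.ob₁ * (m.M - m.o₁) ≤ (m.b₁ - m.o₁b₁) * m.o₂)
    (hA4' : m.bo₁ * (m.M - m.b₁) ≤ (m.o₁ - m.o₁b₁) * m.b)
    (hA5 : m.M * m.ob₁ ≤ m.b₁ * m.oU) (hA5' : m.M * m.bo₁ ≤ m.o₁ * m.bU)
    (hA6 : (m.M - m.bU) * m.ob₁ ≤ (m.oU - m.oUbU) * m.b₁)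
    (hA7' : m.ob₁ * (m.M - m.b) ≤ (m.o₂ - m.ob) * m.b₁) : 0 ≤ tmB22 m := by
  unfold tmB22
  rw [hoU, hbU, hoUbU] at hcNN
  rw [hoU] at hA5
  rw [hbU] at hA5'
  rw [hbU, hoU, hoUbU] at hA6
  rw [hoU, hbU, hoUbU]
  have t1 := mul_nonneg (sub_nonneg.2 hA7') hc12
  have t2 := mul_nonneg (sub_nonneg.2 hA4) hc2N
  have t3 := mul_nonneg (sub_nonneg.2 hA4') hc11
  have t4 := mul_nonneg (sub_nonneg.2 hA4') hc12
  have t5 := mul_nonneg (sub_nonneg.2 hA4') hc1N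
  have t6 := mul_nonneg (sub_nonneg.2 hA4') hc21
  have t7 := mul_nonneg (sub_nonneg.2 hA4') hc22
  have t8 := mul_nonneg (sub_nonneg.2 hA4') hc2N
  have t9 := mul_nonneg (sub_nonneg.2 hA6) hc22
  have t10 := mul_nonneg (sub_nonneg.2 hA6) hcN2
  have t11 := mul_nonneg (sub_nonneg.2 hA5) hc22
  have t12 := mul_nonneg (sub_nonneg.2 hA5) hcN2
  have t13 := mul_nonneg (sub_nonneg.2 hA5') hc2N
  have t14 := mul_nonneg (mul_nonneg hc11 hc12) hc2N
  have t15 := mul_nonneg (mul_nonneg hc11 hc12) hcNN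
  have t16 := mul_nonneg (mul_nonneg hc11 hc1N) hc2N
  have t17 := mul_nonneg (mul_nonneg hc11 hc22) hc2N
  have t18 := mul_nonneg (mul_nonneg hc11 hc2N) hc2N
  have t19 := mul_nonneg (mul_nonneg hc12 hc12) hc2N
  have t20 := mul_nonneg (mul_nonneg hc12 hc12) hcNN
  have t21 := mul_nonneg (mul_nonneg hc12 hc1N) hc21
  have t22 := mul_nonneg (mul_nonneg hc12 hc1N) hc2N
  have t23 := mul_nonneg (mul_nonneg hc12 hc1N) hcNN
  have t24 := mul_nonneg (mul_nonneg hc12 hc21) hc2N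
  have t25 := mul_nonneg (mul_nonneg hc12 hc21) hcNN
  have t26 := mul_nonneg (mul_nonneg hc12 hc22) hc2N
  have t27 := mul_nonneg (mul_nonneg hc12 hc22) hcNN
  have t28 := mul_nonneg (mul_nonneg hc12 hc2N) hc2N
  have t29 := mul_nonneg (mul_nonneg hc12 hc2N) hcNN
  have t30 := mul_nonneg (mul_nonneg hc1N hc1N) hc2N
  have t31 := mul_nonneg (mul_nonneg hc1N hc22) hc2N
  have t32 := mul_nonneg (mul_nonneg hc1N hc2N) hc2N
  linarith [t1, t2, t3, t4, t5, t6, t7, t8, t9, t10, t11, t12, t13, t14, t15, t16, t17, t18, t19, t20, t21, t22, t23, t24, t25, t26, t27, t28, t29, t30, t31, t32]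

/-- **`9·B₂₁ ≥ 0`, the cell certificate** (40 terms): BHK 1.3 on `C₁` (`hA1'`), BHK 1.4 `b ∈ C₂` vs
`o ∈ C₁` (`hA2`), BHK 1.4 with `C₂` avoiding `{a₁, o}` (`hA7`), with `C₁` avoiding `{a₂, o}` (`hA4`)
and `{a₂, b}` (`hA4'`), the Q-pair odds conditions at `b` (`hA5`) and at `o` (`hA5'`), each
multiplied by cells, plus cell monomials — an identity modulo the relations. -/
lemma tmB21_nonneg (m : TMMasses R) (hoU : m.oU = m.o₁ + m.o₂) (hbU : m.bU = m.b₁ + m.b)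
    (hoUbU : m.oUbU = m.ob + m.bo₁ + m.ob₁ + m.o₁b₁)
    (hc11 : 0 ≤ m.o₁b₁) (hc12 : 0 ≤ m.bo₁) (hc1N : 0 ≤ m.o₁ - m.o₁b₁ - m.bo₁) (hc21 : 0 ≤ m.ob₁)
    (hc22 : 0 ≤ m.ob) (hc2N : 0 ≤ m.o₂ - m.ob₁ - m.ob) (hcN1 : 0 ≤ m.b₁ - m.o₁b₁ - m.ob₁)
    (hcN2 : 0 ≤ m.b - m.ob - m.bo₁) (hcNN : 0 ≤ m.M - m.oU - m.bU + m.oUbU)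
    (hA1' : m.o₁ * m.b₁ ≤ m.o₁b₁ * m.M) (hA2 : m.M * m.bo₁ ≤ m.b * m.o₁)
    (hA4 : m.ob₁ * (m.M - m.o₁) ≤ (m.b₁ - m.o₁b₁) * m.o₂)
    (hA4' : m.bo₁ * (m.M - m.b₁) ≤ (m.o₁ - m.o₁b₁) * m.b)
    (hA5 : m.M * m.ob₁ ≤ m.b₁ * m.oU) (hA5' : m.M * m.bo₁ ≤ m.o₁ * m.bU)
    (hA7 : m.bo₁ * (m.M - m.o₂) ≤ (m.b - m.ob) * m.o₁) : 0 ≤ tmB21 m := by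
  unfold tmB21
  rw [hoU, hbU, hoUbU] at hcNN
  rw [hoU] at hA5
  rw [hbU] at hA5'
  rw [hoU, hoUbU]
  have t1 := mul_nonneg (sub_nonneg.2 hA1') hc12
  have t2 := mul_nonneg (sub_nonneg.2 hA2) hc2N
  have t3 := mul_nonneg (sub_nonneg.2 hA7) hc21
  have t4 := mul_nonneg (sub_nonneg.2 hA4) hc12
  have t5 := mul_nonneg (sub_nonneg.2 hA4) hc22
  have t6 := mul_nonneg (sub_nonneg.2 hA4') hc11
  have t7 := mul_nonneg (sub_nonneg.2 hA4') hc12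
  have t8 := mul_nonneg (sub_nonneg.2 hA4') hc1N
  have t9 := mul_nonneg (sub_nonneg.2 hA4') hc21
  have t10 := mul_nonneg (sub_nonneg.2 hA4') hc22
  have t11 := mul_nonneg (sub_nonneg.2 hA4') hc2N
  have t12 := mul_nonneg (sub_nonneg.2 hA5) hcN2
  have t13 := mul_nonneg (sub_nonneg.2 hA5') hc22
  have t14 := mul_nonneg (mul_nonneg hc11 hc11) hc22
  have t15 := mul_nonneg (mul_nonneg hc11 hc11) hc2N
  have t16 := mul_nonneg (mul_nonneg hc11 hc11) hcN2
  have t17 := mul_nonneg (mul_nonneg hc11 hc12) hc2N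
  have t18 := mul_nonneg (mul_nonneg hc11 hc12) hcNN
  have t19 := mul_nonneg (mul_nonneg hc11 hc1N) hc2N
  have t20 := mul_nonneg (mul_nonneg hc11 hc21) hc22
  have t21 := mul_nonneg (mul_nonneg hc11 hc21) hc2N
  have t22 := mul_nonneg (mul_nonneg hc11 hc22) hc22
  have t23 := mul_nonneg (mul_nonneg hc11 hc22) hc2N
  have t24 := mul_nonneg (mul_nonneg hc11 hc2N) hc2N
  have t25 := mul_nonneg (mul_nonneg hc12 hc12) hc21
  have t26 := mul_nonneg (mul_nonneg hc12 hc12) hc2N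
  have t27 := mul_nonneg (mul_nonneg hc12 hc12) hcN1
  have t28 := mul_nonneg (mul_nonneg hc12 hc12) hcNN
  have t29 := mul_nonneg (mul_nonneg hc12 hc1N) hc2N
  have t30 := mul_nonneg (mul_nonneg hc12 hc1N) hcNN
  have t31 := mul_nonneg (mul_nonneg hc12 hc21) hc2N
  have t32 := mul_nonneg (mul_nonneg hc12 hc21) hcNN
  have t33 := mul_nonneg (mul_nonneg hc12 hc22) hc2N
  have t34 := mul_nonneg (mul_nonneg hc12 hc22) hcNN
  have t35 := mul_nonneg (mul_nonneg hc12 hc2N) hc2N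
  have t36 := mul_nonneg (mul_nonneg hc12 hc2N) hcNN
  have t37 := mul_nonneg (mul_nonneg hc1N hc1N) hc2N
  have t38 := mul_nonneg (mul_nonneg hc1N hc21) hc2N
  have t39 := mul_nonneg (mul_nonneg hc1N hc22) hc2N
  have t40 := mul_nonneg (mul_nonneg hc1N hc2N) hc2N
  linarith [t1, t2, t3, t4, t5, t6, t7, t8, t9, t10, t11, t12, t13, t14, t15, t16, t17, t18, t19, t20, t21, t22, t23, t24, t25, t26, t27, t28, t29, t30, t31, t32, t33, t34, t35, t36, t37, t38, t39, t40]

end CoeffsNonneg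

/-! ## The class is closed -/

section Closed
variable {V : Type*} {E : Type*} [Fintype E] [DecidableEq E] [Fintype V] [DecidableEq V]
  {R : Type*} [Field R] [LinearOrder R] [IsStrictOrderedRing R]
variable {ends : E → Sym2 V} {o b a₃ : V} {eo eb : E}

/-- **`(ii)` for `a₃` adjacent exactly to `o` and `b`, every finite graph, every weight vector.**
The reduction `zSplitII_of_twoMark_of_bern` with the three cell certificates `tmB21_nonneg`,
`tmB22_nonneg`, `tmB23_nonneg`, whose atoms are the BHK 1.3 / 1.4 (+ avoidance) facts and the odds
lemmas at the pinned law `p[eo ↦ 0][eb ↦ 0]`. -/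
theorem zSplitII_of_twoMark (p : E → R) (hp : IsProbVec p)
    (h : IsTwoMarkAt ends o b a₃ eo eb) {a₁ a₂ : V} (h1 : a₁ ≠ a₃) (h2 : a₂ ≠ a₃) :
    ZSplitII p ends o a₁ a₂ a₃ b := by
  set p00 := Function.update (Function.update p eo 0) eb 0 with hp00
  have hp0 : IsProbVec p00 := (hp.update eo le_rfl zero_le_one).update eb le_rfl zero_le_one
  set m := tmMasses p00 ends o a₁ a₂ b with hm
  -- the atoms at the pinned law
  have hA1' : m.o₁ * m.b₁ ≤ m.o₁b₁ * m.M := tm_bhk_same_a1 p00 hp0 ends o a₁ a₂ b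
  have hA2 : m.M * m.bo₁ ≤ m.b * m.o₁ := tm_bhk_cross_o1_b2 p00 hp0 ends o a₁ a₂ b
  have hA4 : m.ob₁ * (m.M - m.o₁) ≤ (m.b₁ - m.o₁b₁) * m.o₂ := tm_bhk_avoid_c1 p00 hp0 ends o a₁ a₂ b
  have hA5 : m.M * m.ob₁ ≤ m.b₁ * m.oU := tm_oddsQ_b p00 hp0 ends o a₁ a₂ b
  have hA5' : m.M * m.bo₁ ≤ m.o₁ * m.bU := tm_oddsQ_o p00 hp0 ends o a₁ a₂ b
  have hA6 : (m.M - m.bU) * m.ob₁ ≤ (m.oU - m.oUbU) * m.b₁ := tm_odds_b p00 hp0 ends o a₁ a₂ b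
  have hA7' : m.ob₁ * (m.M - m.b) ≤ (m.o₂ - m.ob) * m.b₁ := tm_bhk_avoid_c2_b p00 hp0 ends o a₁ a₂ b
  have hA7 : m.bo₁ * (m.M - m.o₂) ≤ (m.b - m.ob) * m.o₁ := by
    have h' := tm_bhk_avoid_c1 p00 hp0 ends o a₂ a₁ b
    rw [connEvent_comm ends a₂ a₁] at h'
    have e : (connEvent ends a₁ a₂)ᶜ ∩ connEvent ends a₂ b ∩ connEvent ends a₁ o =
        (connEvent ends a₁ a₂)ᶜ ∩ connEvent ends a₁ o ∩ connEvent ends a₂ b := Set.inter_right_comm _ _ _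
    rw [prob_congr_set p00 e] at h'
    exact h'
  have hA4' : m.bo₁ * (m.M - m.b₁) ≤ (m.o₁ - m.o₁b₁) * m.b := by
    have h' := tm_bhk_avoid_c1 p00 hp0 ends b a₁ a₂ o
    have e : (connEvent ends a₁ a₂)ᶜ ∩ connEvent ends a₁ b ∩ connEvent ends a₁ o =
        (connEvent ends a₁ a₂)ᶜ ∩ connEvent ends a₁ o ∩ connEvent ends a₁ b := Set.inter_right_comm _ _ _
    rw [prob_congr_set p00 e] at h'
    exact h'
  -- the nine cells are nonnegative
  have hc11 : 0 ≤ m.o₁b₁ := prob_nonneg hp0 _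
  have hc12 : 0 ≤ m.bo₁ := prob_nonneg hp0 _
  have hc21 : 0 ≤ m.ob₁ := prob_nonneg hp0 _
  have hc22 : 0 ≤ m.ob := prob_nonneg hp0 _
  -- a generic cell: `P(Q₀ ∩ X) − P(Q₀ ∩ X ∩ {a₁ ↔ y}) − P(Q₀ ∩ X ∩ {a₂ ↔ y}) ≥ 0`
  have cell : ∀ (X : Set (E → Bool)) (y : V),
      0 ≤ prob p00 ((connEvent ends a₁ a₂)ᶜ ∩ X) -
        prob p00 ((connEvent ends a₁ a₂)ᶜ ∩ X ∩ connEvent ends a₁ y) -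
        prob p00 ((connEvent ends a₁ a₂)ᶜ ∩ X ∩ connEvent ends a₂ y) := by
    intro X y
    have s1 := prob_inter_add_prob_inter_compl p00 ((connEvent ends a₁ a₂)ᶜ ∩ X)
      (connEvent ends a₁ y ∪ connEvent ends a₂ y)
    have h0 := prob_nonneg hp0 ((connEvent ends a₁ a₂)ᶜ ∩ X ∩
      (connEvent ends a₁ y ∪ connEvent ends a₂ y)ᶜ)
    have e : (connEvent ends a₁ a₂)ᶜ ∩ X ∩ (connEvent ends a₁ y ∪ connEvent ends a₂ y) =
        ((connEvent ends a₁ a₂)ᶜ ∩ X ∩ connEvent ends a₁ y) ∪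
          ((connEvent ends a₁ a₂)ᶜ ∩ X ∩ connEvent ends a₂ y) := by
      ext ω
      simp only [Set.mem_inter_iff, Set.mem_union, Set.mem_compl_iff]
      tauto
    have d : Disjoint ((connEvent ends a₁ a₂)ᶜ ∩ X ∩ connEvent ends a₁ y)
        ((connEvent ends a₁ a₂)ᶜ ∩ X ∩ connEvent ends a₂ y) :=
      Set.disjoint_left.2 fun _ hω hω' => hω.1.1 (conn_trans hω.2 (conn_symm hω'.2))
    rw [e, prob_union_of_disjoint p00 d] at s1
    linarith [s1, h0]
  have hc1N : 0 ≤ m.o₁ - m.o₁b₁ - m.bo₁ := cell (connEvent ends a₁ o) b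
  have hcN2 : 0 ≤ m.b - m.ob - m.bo₁ := by
    have c := cell (connEvent ends a₂ b) o
    have e1 : (connEvent ends a₁ a₂)ᶜ ∩ connEvent ends a₂ b ∩ connEvent ends a₁ o =
        (connEvent ends a₁ a₂)ᶜ ∩ connEvent ends a₁ o ∩ connEvent ends a₂ b := Set.inter_right_comm _ _ _
    have e2 : (connEvent ends a₁ a₂)ᶜ ∩ connEvent ends a₂ b ∩ connEvent ends a₂ o =
        (connEvent ends a₁ a₂)ᶜ ∩ connEvent ends a₂ o ∩ connEvent ends a₂ b := Set.inter_right_comm _ _ _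
    rw [prob_congr_set p00 e1, prob_congr_set p00 e2] at c
    show 0 ≤ prob p00 _ - prob p00 _ - prob p00 _
    linarith [c]
  have hc2N : 0 ≤ m.o₂ - m.ob₁ - m.ob := by
    have c := cell (connEvent ends a₂ o) b
    have e1 : (connEvent ends a₁ a₂)ᶜ ∩ connEvent ends a₂ o ∩ connEvent ends a₁ b =
        (connEvent ends a₁ a₂)ᶜ ∩ connEvent ends a₁ b ∩ connEvent ends a₂ o := Set.inter_right_comm _ _ _
    rw [prob_congr_set p00 e1] at c
    show 0 ≤ prob p00 _ - prob p00 _ - prob p00 _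
    linarith [c]
  have hcN1 : 0 ≤ m.b₁ - m.o₁b₁ - m.ob₁ := by
    have c := cell (connEvent ends a₁ b) o
    have e1 : (connEvent ends a₁ a₂)ᶜ ∩ connEvent ends a₁ b ∩ connEvent ends a₁ o =
        (connEvent ends a₁ a₂)ᶜ ∩ connEvent ends a₁ o ∩ connEvent ends a₁ b := Set.inter_right_comm _ _ _
    rw [prob_congr_set p00 e1] at c
    show 0 ≤ prob p00 _ - prob p00 _ - prob p00 _
    linarith [c]
  have hcNN : 0 ≤ m.M - m.oU - m.bU + m.oUbU := by
    have s1 := prob_inter_add_prob_inter_compl p00 (connEvent ends a₁ a₂)ᶜ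
      (connEvent ends a₁ o ∪ connEvent ends a₂ o)
    have s2 := prob_inter_add_prob_inter_compl p00
      ((connEvent ends a₁ a₂)ᶜ ∩ (connEvent ends a₁ o ∪ connEvent ends a₂ o)ᶜ)
      (connEvent ends a₁ b ∪ connEvent ends a₂ b)
    have s3 := prob_inter_add_prob_inter_compl p00
      ((connEvent ends a₁ a₂)ᶜ ∩ (connEvent ends a₁ b ∪ connEvent ends a₂ b))
      (connEvent ends a₁ o ∪ connEvent ends a₂ o)
    have h0 := prob_nonneg hp0 ((connEvent ends a₁ a₂)ᶜ ∩ (connEvent ends a₁ o ∪ connEvent ends a₂ o)ᶜ ∩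
      (connEvent ends a₁ b ∪ connEvent ends a₂ b)ᶜ)
    have e1 : (connEvent ends a₁ a₂)ᶜ ∩ (connEvent ends a₁ b ∪ connEvent ends a₂ b) ∩
        (connEvent ends a₁ o ∪ connEvent ends a₂ o) =
        (connEvent ends a₁ a₂)ᶜ ∩ (connEvent ends a₁ o ∪ connEvent ends a₂ o) ∩
          (connEvent ends a₁ b ∪ connEvent ends a₂ b) := Set.inter_right_comm _ _ _
    have e2 : (connEvent ends a₁ a₂)ᶜ ∩ (connEvent ends a₁ b ∪ connEvent ends a₂ b) ∩
        (connEvent ends a₁ o ∪ connEvent ends a₂ o)ᶜ =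
        (connEvent ends a₁ a₂)ᶜ ∩ (connEvent ends a₁ o ∪ connEvent ends a₂ o)ᶜ ∩
          (connEvent ends a₁ b ∪ connEvent ends a₂ b) := Set.inter_right_comm _ _ _
    rw [e1, e2] at s3
    show 0 ≤ prob p00 _ - prob p00 _ - prob p00 _ + prob p00 _
    linarith [s1, s2, s3, h0]
  exact zSplitII_of_twoMark_of_bern p hp h h1 h2
    (tmB21_nonneg m (tmMasses_oU p00 a₁ a₂) (tmMasses_bU p00 a₁ a₂) (tmMasses_oUbU p00 a₁ a₂)
      hc11 hc12 hc1N hc21 hc22 hc2N hcN1 hcN2 hcNN hA1' hA2 hA4 hA4' hA5 hA5' hA7)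
    (tmB22_nonneg m (tmMasses_oU p00 a₁ a₂) (tmMasses_bU p00 a₁ a₂) (tmMasses_oUbU p00 a₁ a₂)
      hc11 hc12 hc1N hc21 hc22 hc2N hcN2 hcNN hA4 hA4' hA5 hA5' hA6 hA7')
    (tmB23_nonneg m (tmMasses_oU p00 a₁ a₂) (tmMasses_bU p00 a₁ a₂) (tmMasses_oUbU p00 a₁ a₂)
      hc12 hc1N hc22 hc2N hcN2 hcNN hA4' hA6)

/-- **`(RV)` for `a₃` adjacent exactly to `o` and `b`** (when the required-vertex world has mass). -/
theorem rv_of_twoMark (p : E → R) (hp : IsProbVec p) (h : IsTwoMarkAt ends o b a₃ eo eb)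
    {a₁ a₂ : V} (h1 : a₁ ≠ a₃) (h2 : a₂ ≠ a₃) (hT : 0 < prob p (Tp ends a₁ a₂ a₃)) :
    RV p ends o a₁ a₂ a₃ b :=
  (rv_iff_ii p ends o a₁ a₂ a₃ b hT).2 (zSplitII_of_twoMark p hp h h1 h2)

end Closed

end CaseOne

end Summit.Ventures.PercRepro2
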